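import Summits.QuantumAdvantage.QuantumAdvantage.Theorems.LinnikCubicClassGroupsPureCubicClassNumberHardGenusUnits
import Summits.QuantumAdvantage.QuantumAdvantage.Theorems.LinnikCubicClassGroupsPureCubicClassNumberHardGenusIdeals

/-!
# Crux `LinnikCubicClassGroups.PureCubicClassNumberHard` (stmt-QuantumAdvantage-11826) —
# genus theory for `N = ℚ(ζ₃, ∛(pq)) / ℚ(ζ₃)`, part 4: invariant ideals; the ramified primes are principal

Line `Sketch` (honda-leak arm), towards / including the lead's stub `stub_ambiguousTrivial`
(`3 ∤ h_N`).  Setting of part 1 (`…GenusSetup`): a Galois number field `N` of degree `6`,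
`ζ² + ζ + 1 = 0`, `σ ≠ 1` fixing `ζ`, `F = ℚ(ζ)`, `Gal(N/F) = ⟨σ⟩`.

* `genus_invariant_eq` — a `⟨σ⟩`-stable fractional ideal is `(c) · P^a · Q^b` with `c ∈ ℚ(ζ)ˣ`
  (landed stubs `stub_invariantIdeal` + `stub_unramifiedOutside`, taken as hypothesis `hinvI'`);
* `genus_isPrincipal` — **the totally ramified primes are principal**: Hilbert 90 attaches to a
  norm-one unit `a` an element `y_a` with `(y_a)` stable; `(v_P(y_a), v_Q(y_a)) mod 3` separates
  `H¹(σ, E_N)` (`#H¹ ≥ 9`, part 2) into `(ℤ/3)²`, hence is onto, and `(1,0)` exhibits a generator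
  of `P`.
-/

set_option linter.dupNamespace false -- D-0017 (Summits/<S>/<S>/… by design)

namespace Summit.QuantumAdvantage.QuantumAdvantage.Theorems.LinnikCubicClassGroups

open NumberField IsDedekindDomain
open scoped IntermediateField nonZeroDivisors

variable {N : Type} [Field N] [NumberField N]

variable [IsGalois ℚ N]

/-! ## Part 4: invariant ideals and classes -/


omit [IsGalois ℚ N] in
/-- Every rational prime lies in some maximal ideal of `𝓞 N`. [folklore] -/
theorem genus_exists_isMaximal_natCast_mem {p : ℕ} (hp : p.Prime) :
    ∃ w : Ideal (𝓞 N), w.IsMaximal ∧ (p : 𝓞 N) ∈ w := by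
  haveI hpmax : (Ideal.span {(p : ℤ)}).IsMaximal :=
    Ideal.IsPrime.isMaximal
      ((Ideal.span_singleton_prime (by exact_mod_cast hp.ne_zero)).mpr
        (Nat.prime_iff_prime_int.mp hp)) (by simpa using hp.ne_zero)
  obtain ⟨Q, hQmax, hQ⟩ := Ideal.exists_ideal_over_maximal_of_isIntegral (S := 𝓞 N)
    (Ideal.span {(p : ℤ)}) (by
      rw [(RingHom.injective_iff_ker_eq_bot _).mp (algebraMap ℤ (𝓞 N)).injective_int]
      exact bot_le)
  refine ⟨Q, hQmax, ?_⟩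
  have hmem : ((p : ℕ) : ℤ) ∈ Q.comap (algebraMap ℤ (𝓞 N)) := by
    rw [hQ]; exact Ideal.mem_span_singleton_self _
  rw [Ideal.mem_comap, map_natCast] at hmem
  exact hmem

omit [IsGalois ℚ N] in
/-- **Invariant fractional ideals are `(c) · P^a · Q^b`, `c ∈ ℚ(ζ)ˣ`** — the combination of the
landed stubs `stub_invariantIdeal` (hypothesis `hinvI`, here already specialised to the unramified
primes `≠ P, Q` via `stub_unramifiedOutside`). [folklore] -/
theorem genus_invariant_eq {ζ : N} {P Q : HeightOneSpectrum (𝓞 N)} (hPQ : P ≠ Q)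
    (hinvI' : ∀ (I : FractionalIdeal (𝓞 N)⁰ N), I ≠ 0 →
      (∀ g : N ≃ₐ[ℚ] N, g ∈ (ℚ⟮ζ⟯).fixingSubgroup → ∀ x ∈ I, g x ∈ I) →
      ∃ c : ℚ⟮ζ⟯, c ≠ 0 ∧ ∀ w : HeightOneSpectrum (𝓞 N), w ≠ P → w ≠ Q →
        FractionalIdeal.count N w I =
          FractionalIdeal.count N w (FractionalIdeal.spanSingleton (𝓞 N)⁰ ((c : N))))
    {I : FractionalIdeal (𝓞 N)⁰ N} (hI : I ≠ 0)
    (hstab : ∀ g : N ≃ₐ[ℚ] N, g ∈ (ℚ⟮ζ⟯).fixingSubgroup → ∀ x ∈ I, g x ∈ I) :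
    ∃ c : ℚ⟮ζ⟯, c ≠ 0 ∧ ∃ a b : ℤ, I = FractionalIdeal.spanSingleton (𝓞 N)⁰ (c : N) *
      (P.asIdeal : FractionalIdeal (𝓞 N)⁰ N) ^ a * (Q.asIdeal : FractionalIdeal (𝓞 N)⁰ N) ^ b := by
  obtain ⟨c, hc0, hc⟩ := hinvI' I hI hstab
  have hcN : (c : N) ≠ 0 := by exact_mod_cast hc0
  set C := FractionalIdeal.spanSingleton (𝓞 N)⁰ (c : N) with hC
  have hC0 : C ≠ 0 := FractionalIdeal.spanSingleton_ne_zero_iff.mpr hcN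
  set J := I * C⁻¹ with hJ
  have hJ0 : J ≠ 0 := mul_ne_zero hI (inv_ne_zero hC0)
  have hJcount : ∀ v : HeightOneSpectrum (𝓞 N), v ≠ P → v ≠ Q → FractionalIdeal.count N v J = 0 := by
    intro v hvP hvQ
    rw [hJ, FractionalIdeal.count_mul N v hI (inv_ne_zero hC0), FractionalIdeal.count_inv,
      hc v hvP hvQ]
    ring
  refine ⟨c, hc0, FractionalIdeal.count N P J, FractionalIdeal.count N Q J, ?_⟩
  rw [mul_assoc, ← genus_eq_zpow_mul_zpow hPQ hJ0 hJcount, hJ, ← hC, mul_comm I, ← mul_assoc,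
    mul_inv_cancel₀ hC0, one_mul]


/-! ### The totally ramified primes are principal -/

open Literature.NumberTheory.GaloisRepresentations
open Literature.NumberTheory.GaloisRepresentations.MinkowskiUnit in
/-- **`P` is principal.**  For a norm-one unit `a` choose `y_a` with `y_a / σ y_a = a`
(Hilbert 90); `(y_a)` is `⟨σ⟩`-stable, and `Φ(a) = (v_P(y_a), v_Q(y_a)) mod 3` is constant on
`a · (σ-1)E_N` and separates the classes of `H¹ = {norm 1}/(σ-1)E_N` (two units with the same `Φ`
differ by `σe/e`: `(y_{a'}/y_a) = (c) P^{3i} Q^{3j} = (c p^i q^j)` with `c ∈ ℚ(ζ)`), so `Φ` induces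
an injection of a set with `#H¹ ≥ 9` elements into `(ℤ/3)²`; it is onto, and a unit with
`Φ = (1, 0)` gives `(y) = (c) P^{1+3i} Q^{3j}`, i.e. `P = (y c⁻¹ p^{-i} q^{-j})`. [folklore] -/
theorem genus_isPrincipal (hN : Module.finrank ℚ N = 6) {ζ : N} (hζ : ζ ^ 2 + ζ + 1 = 0)
    {σ : N ≃ₐ[ℚ] N} (hσζ : σ ζ = ζ) (hσ1 : σ ≠ 1) (hnorm : ∀ x : N, x * σ x * σ (σ x) ≠ ζ)
    {p q : ℕ} (hp : p.Prime) (hq : q.Prime) {P Q : HeightOneSpectrum (𝓞 N)} (hPQ : P ≠ Q)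
    (hspanP : Ideal.span {(p : 𝓞 N)} = P.asIdeal ^ 3)
    (hspanQ : Ideal.span {(q : 𝓞 N)} = Q.asIdeal ^ 3)
    (hinvI' : ∀ (I : FractionalIdeal (𝓞 N)⁰ N), I ≠ 0 →
      (∀ g : N ≃ₐ[ℚ] N, g ∈ (ℚ⟮ζ⟯).fixingSubgroup → ∀ x ∈ I, g x ∈ I) →
      ∃ c : ℚ⟮ζ⟯, c ≠ 0 ∧ ∀ w : HeightOneSpectrum (𝓞 N), w ≠ P → w ≠ Q →
        FractionalIdeal.count N w I =
          FractionalIdeal.count N w (FractionalIdeal.spanSingleton (𝓞 N)⁰ ((c : N)))) :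
    ∃ t : N, (P.asIdeal : FractionalIdeal (𝓞 N)⁰ N) = FractionalIdeal.spanSingleton (𝓞 N)⁰ t := by
  classical
  have hζ' := genus_isPrimitiveRoot hζ
  obtain ⟨τ, hτσ, hτ⟩ := genus_exists_algEquiv hN hζ' hσζ hσ1
  have h9 := genus_nine_le_h1 hN hζ hσζ hσ1 hnorm hτσ hτ
  have hHeq := genus_fixingSubgroup_eq_zpowers hN hζ' hσζ hσ1
  set A : Subgroup Nˣ := unitsE N with hA
  set Z : Subgroup Nˣ := Herbrand.z1 (N ≃ₐ[ℚ⟮ζ⟯] N) A ⊥ with hZ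
  set B : Subgroup Nˣ := Herbrand.b1 τ A ⊥ with hB
  have hnat : ∀ r : ℕ, σ (r : N) = r := fun r => map_natCast σ r
  -- norm-one units and their Hilbert-90 witnesses
  have hZnorm : ∀ a : Z, ((a : Nˣ) : N) * σ ((a : Nˣ) : N) * σ (σ ((a : Nˣ) : N)) = 1 := by
    intro a
    have ha := (Herbrand.mem_z1_bot.mp a.2).2
    have := genus_val_herbrandNorm hN hζ' hσζ hσ1 (a : Nˣ)
    rw [ha, Units.val_one] at this
    exact this.symm
  choose y hy0 hy using fun a : Z => genus_hilbert90 hN hζ' hσζ hσ1 (hZnorm a)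
  -- `σ (y a) = y a · a⁻¹`, an integral-unit multiple
  have hZA : ∀ a : Z, (a : Nˣ) ∈ A := fun a => (Herbrand.mem_z1_bot.mp a.2).1
  set w : Z → (𝓞 N)ˣ := fun a => (Classical.choose (mem_unitsE_iff.mp (hZA a)))⁻¹ with hwdef
  have hwval : ∀ a : Z, ((w a : 𝓞 N) : N) = (((a : Nˣ) : N))⁻¹ := by
    intro a
    set u := Classical.choose (mem_unitsE_iff.mp (hZA a)) with hu
    have hu' : Units.map (algebraMap (𝓞 N) N : 𝓞 N →* N) u = (a : Nˣ) :=
      Classical.choose_spec (mem_unitsE_iff.mp (hZA a))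
    have hval : ((u : 𝓞 N) : N) = ((a : Nˣ) : N) := by
      rw [← hu']; rfl
    have hinv : ((↑(u⁻¹ : (𝓞 N)ˣ) : 𝓞 N) : N) * ((u : 𝓞 N) : N) = 1 := by
      have h := congrArg (fun z : 𝓞 N => (z : N)) u.inv_mul
      push_cast at h
      exact h
    rw [hval] at hinv
    exact eq_inv_of_mul_eq_one_left hinv
  have hσy : ∀ a : Z, σ (y a) = ((w a : 𝓞 N) : N) * y a := by
    intro a
    have h1 := hy a
    have hσy0 : σ (y a) ≠ 0 := (map_ne_zero σ).mpr (hy0 a)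
    rw [div_eq_iff hσy0] at h1
    have ha0 : ((a : Nˣ) : N) ≠ 0 := Units.ne_zero _
    rw [hwval]
    calc σ (y a) = ((((a : Nˣ) : N))⁻¹ * ((a : Nˣ) : N)) * σ (y a) := by
            rw [inv_mul_cancel₀ ha0, one_mul]
      _ = (((a : Nˣ) : N))⁻¹ * (((a : Nˣ) : N) * σ (y a)) := by ring
      _ = _ := by rw [← h1]
  -- stability of `(y a)` under `Gal(N/ℚ(ζ)) = ⟨σ⟩`
  have hstab : ∀ a : Z, ∀ g : N ≃ₐ[ℚ] N, g ∈ (ℚ⟮ζ⟯).fixingSubgroup →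
      ∀ x ∈ FractionalIdeal.spanSingleton (𝓞 N)⁰ (y a),
        g x ∈ FractionalIdeal.spanSingleton (𝓞 N)⁰ (y a) := by
    intro a g hg x hx
    rw [hHeq] at hg
    exact genus_spanSingleton_stable (hσy a) hg hx
  -- KEY: an `H`-stable principal ideal `(t)` is `(c) P^i Q^j` with `v_P(t) ≡ i`, `v_Q(t) ≡ j (mod 3)`
  have key : ∀ t : N, t ≠ 0 →
      (∀ g : N ≃ₐ[ℚ] N, g ∈ (ℚ⟮ζ⟯).fixingSubgroup →
        ∀ x ∈ FractionalIdeal.spanSingleton (𝓞 N)⁰ t, g x ∈ FractionalIdeal.spanSingleton (𝓞 N)⁰ t) →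
      ∃ c : ℚ⟮ζ⟯, c ≠ 0 ∧ ∃ i j : ℤ,
        FractionalIdeal.spanSingleton (𝓞 N)⁰ t = FractionalIdeal.spanSingleton (𝓞 N)⁰ (c : N) *
          (P.asIdeal : FractionalIdeal (𝓞 N)⁰ N) ^ i * (Q.asIdeal : FractionalIdeal (𝓞 N)⁰ N) ^ j ∧
        (3 : ℤ) ∣ FractionalIdeal.count N P (FractionalIdeal.spanSingleton (𝓞 N)⁰ t) - i ∧
        (3 : ℤ) ∣ FractionalIdeal.count N Q (FractionalIdeal.spanSingleton (𝓞 N)⁰ t) - j := by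
    intro t ht htstab
    have ht0 : FractionalIdeal.spanSingleton (𝓞 N)⁰ t ≠ 0 :=
      FractionalIdeal.spanSingleton_ne_zero_iff.mpr ht
    obtain ⟨c, hc0, i, j, heq⟩ := genus_invariant_eq hPQ hinvI' ht0 htstab
    refine ⟨c, hc0, i, j, heq, ?_, ?_⟩
    · have hcN : (c : N) ≠ 0 := by exact_mod_cast hc0
      have hC0 : FractionalIdeal.spanSingleton (𝓞 N)⁰ (c : N) ≠ 0 :=
        FractionalIdeal.spanSingleton_ne_zero_iff.mpr hcN
      have hPi : (P.asIdeal : FractionalIdeal (𝓞 N)⁰ N) ^ i ≠ 0 :=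
        zpow_ne_zero _ (FractionalIdeal.coeIdeal_ne_zero.mpr P.ne_bot)
      have hQj : (Q.asIdeal : FractionalIdeal (𝓞 N)⁰ N) ^ j ≠ 0 :=
        zpow_ne_zero _ (FractionalIdeal.coeIdeal_ne_zero.mpr Q.ne_bot)
      rw [heq, FractionalIdeal.count_mul N P (mul_ne_zero hC0 hPi) hQj,
        FractionalIdeal.count_mul N P hC0 hPi, FractionalIdeal.count_zpow_self,
        FractionalIdeal.count_zpow, FractionalIdeal.count_maximal_coprime N P hPQ.symm]
      obtain ⟨k, hk⟩ := genus_three_dvd_count_adjoin hζ' hp P hspanP hc0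
      exact ⟨k, by rw [hk]; ring⟩
    · have hcN : (c : N) ≠ 0 := by exact_mod_cast hc0
      have hC0 : FractionalIdeal.spanSingleton (𝓞 N)⁰ (c : N) ≠ 0 :=
        FractionalIdeal.spanSingleton_ne_zero_iff.mpr hcN
      have hPi : (P.asIdeal : FractionalIdeal (𝓞 N)⁰ N) ^ i ≠ 0 :=
        zpow_ne_zero _ (FractionalIdeal.coeIdeal_ne_zero.mpr P.ne_bot)
      have hQj : (Q.asIdeal : FractionalIdeal (𝓞 N)⁰ N) ^ j ≠ 0 :=
        zpow_ne_zero _ (FractionalIdeal.coeIdeal_ne_zero.mpr Q.ne_bot)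
      rw [heq, FractionalIdeal.count_mul N Q (mul_ne_zero hC0 hPi) hQj,
        FractionalIdeal.count_mul N Q hC0 hPi, FractionalIdeal.count_zpow_self,
        FractionalIdeal.count_zpow, FractionalIdeal.count_maximal_coprime N Q hPQ]
      obtain ⟨k, hk⟩ := genus_three_dvd_count_adjoin hζ' hq Q hspanQ hc0
      exact ⟨k, by rw [hk]; ring⟩
  -- a `σ`-fixed generator: `(c) P^{3i} Q^{3j} = (c p^i q^j)`
  have hfixgen : ∀ (c : ℚ⟮ζ⟯) (i j : ℤ),
      FractionalIdeal.spanSingleton (𝓞 N)⁰ (c : N) *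
        (P.asIdeal : FractionalIdeal (𝓞 N)⁰ N) ^ (3 * i) *
        (Q.asIdeal : FractionalIdeal (𝓞 N)⁰ N) ^ (3 * j) =
      FractionalIdeal.spanSingleton (𝓞 N)⁰ ((c : N) * (p : N) ^ i * (q : N) ^ j) ∧
      σ ((c : N) * (p : N) ^ i * (q : N) ^ j) = (c : N) * (p : N) ^ i * (q : N) ^ j := by
    intro c i j
    constructor
    · rw [← genus_count_natCast_zpow P hspanP, ← genus_count_natCast_zpow Q hspanQ,
        FractionalIdeal.spanSingleton_mul_spanSingleton, FractionalIdeal.spanSingleton_mul_spanSingleton]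
    · rw [map_mul, map_mul, map_zpow₀, map_zpow₀, hnat, hnat, genus_fixed_of_mem_adjoin hσζ c.2]
  -- the invariant `Φ`
  set Φ : Z → ZMod 3 × ZMod 3 := fun a =>
    (((FractionalIdeal.count N P (FractionalIdeal.spanSingleton (𝓞 N)⁰ (y a)) : ℤ) : ZMod 3),
     ((FractionalIdeal.count N Q (FractionalIdeal.spanSingleton (𝓞 N)⁰ (y a)) : ℤ) : ZMod 3)) with hΦ
  -- INJ: equal `Φ` ⟹ same class modulo `B = (σ-1) E_N`
  have hinj : ∀ a a' : Z, Φ a = Φ a' → ((a : Nˣ))⁻¹ * (a' : Nˣ) ∈ B := by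
    intro a a' hΦeq
    simp only [hΦ, Prod.mk.injEq] at hΦeq
    obtain ⟨hΦP, hΦQ⟩ := hΦeq
    rw [ZMod.intCast_eq_intCast_iff_dvd_sub] at hΦP hΦQ
    -- `t = y a' / y a`, `σ t = (a a'⁻¹) t`
    set t : N := y a' / y a with htdef
    have ht0 : t ≠ 0 := div_ne_zero (hy0 a') (hy0 a)
    set e₀ : Nˣ := (a : Nˣ) * (a' : Nˣ)⁻¹ with he₀
    have he₀A : e₀ ∈ A := A.mul_mem (hZA a) (A.inv_mem (hZA a'))
    obtain ⟨u₀, hu₀⟩ := mem_unitsE_iff.mp he₀A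
    have hu₀val : ((u₀ : 𝓞 N) : N) = ((e₀ : Nˣ) : N) := by rw [← hu₀]; rfl
    have hσt : σ t = ((u₀ : 𝓞 N) : N) * t := by
      rw [hu₀val, he₀, Units.val_mul, Units.val_inv_eq_inv_val, htdef, map_div₀, hσy a, hσy a',
        hwval, hwval]
      field_simp
    have htstab : ∀ g : N ≃ₐ[ℚ] N, g ∈ (ℚ⟮ζ⟯).fixingSubgroup →
        ∀ x ∈ FractionalIdeal.spanSingleton (𝓞 N)⁰ t, g x ∈ FractionalIdeal.spanSingleton (𝓞 N)⁰ t := by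
      intro g hg x hx
      rw [hHeq] at hg
      exact genus_spanSingleton_stable hσt hg hx
    obtain ⟨c, hc0, i, j, heq, hiP, hjQ⟩ := key t ht0 htstab
    -- counts of `(t)` are differences, so `3 ∣ i`, `3 ∣ j`
    have hcount : ∀ v : HeightOneSpectrum (𝓞 N),
        FractionalIdeal.count N v (FractionalIdeal.spanSingleton (𝓞 N)⁰ t) =
          FractionalIdeal.count N v (FractionalIdeal.spanSingleton (𝓞 N)⁰ (y a')) -
          FractionalIdeal.count N v (FractionalIdeal.spanSingleton (𝓞 N)⁰ (y a)) := by
      intro v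
      rw [htdef, div_eq_mul_inv, ← FractionalIdeal.spanSingleton_mul_spanSingleton,
        ← FractionalIdeal.spanSingleton_inv,
        FractionalIdeal.count_mul N v (FractionalIdeal.spanSingleton_ne_zero_iff.mpr (hy0 a'))
          (inv_ne_zero (FractionalIdeal.spanSingleton_ne_zero_iff.mpr (hy0 a))),
        FractionalIdeal.count_inv]
      ring
    rw [hcount] at hiP hjQ
    obtain ⟨i₁, rfl⟩ : (3 : ℤ) ∣ i := by
      have := dvd_sub hiP hΦP
      -- hΦP : 3 ∣ count(y a') - count(y a)  (as ℕ-cast 3)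
      simpa using dvd_sub hΦP hiP
    obtain ⟨j₁, rfl⟩ : (3 : ℤ) ∣ j := by
      simpa using dvd_sub hΦQ hjQ
    -- `(t) = (s)` with `s = c p^{i₁} q^{j₁}` fixed by `σ`
    obtain ⟨hgen, hσs⟩ := hfixgen c i₁ j₁
    rw [hgen] at heq
    obtain ⟨e, he⟩ := FractionalIdeal.spanSingleton_eq_spanSingleton.mp heq.symm
    -- `e • s = t`
    set s₀ : N := (c : N) * (p : N) ^ i₁ * (q : N) ^ j₁ with hs₀
    have hs₀0 : s₀ ≠ 0 := by
      have hcN : (c : N) ≠ 0 := by exact_mod_cast hc0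
      have hp0 : (p : N) ≠ 0 := by exact_mod_cast hp.ne_zero
      have hq0 : (q : N) ≠ 0 := by exact_mod_cast hq.ne_zero
      exact mul_ne_zero (mul_ne_zero hcN (zpow_ne_zero _ hp0)) (zpow_ne_zero _ hq0)
    have het : ((e : 𝓞 N) : N) * s₀ = t := by
      rw [← he, Units.smul_def, Algebra.smul_def]
    -- compare `σ t = u₀ t` with `σ t = σ(e) s₀`
    have heN0 : ((e : 𝓞 N) : N) ≠ 0 := by
      intro h; apply ht0; rw [← het, h, zero_mul]
    have hratio : ((u₀ : 𝓞 N) : N) = σ ((e : 𝓞 N) : N) / ((e : 𝓞 N) : N) := by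
      have h1 : σ t = σ ((e : 𝓞 N) : N) * s₀ := by rw [← het, map_mul, hσs]
      rw [hσt, ← het, ← mul_assoc] at h1
      rw [eq_div_iff heN0]
      exact mul_right_cancel₀ hs₀0 h1
    -- hence `e₀ = twist τ ê ∈ B`
    set ê : Nˣ := Units.map (algebraMap (𝓞 N) N : 𝓞 N →* N) e with hê
    have hêA : ê ∈ A := mem_unitsE_iff.mpr ⟨e, rfl⟩
    have htwist : Herbrand.twist τ ê = e₀ := by
      apply Units.ext
      rw [Herbrand.twist_apply, Units.val_div_eq_div_val, val_smul, hτσ, ← hu₀val, hratio]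
      rfl
    have he₀B : e₀ ∈ B := Herbrand.map_twist_le_b1 ⟨ê, hêA, htwist⟩
    have : ((a : Nˣ))⁻¹ * (a' : Nˣ) = e₀⁻¹ := by rw [he₀, mul_inv_rev, inv_inv, mul_comm]
    rw [this]
    exact B.inv_mem he₀B
  -- the quotient `Z ⧸ B'` has at least `9` elements, so `Φ` mod `B` is onto `(ℤ/3)²`
  set B' : Subgroup Z := B.subgroupOf Z with hB'
  have hidx : B'.index = Herbrand.h1 τ A ⊥ := rfl
  have hcardQ : 9 ≤ Nat.card (Z ⧸ B') := by rw [← Subgroup.index_eq_card, hidx]; exact h9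
  haveI : Finite (Z ⧸ B') := Nat.finite_of_card_ne_zero (by omega)
  set ψ : Z ⧸ B' → ZMod 3 × ZMod 3 := fun x => Φ (Quotient.out x) with hψ
  have hψinj : Function.Injective ψ := by
    intro x x' h
    have hmem := hinj (Quotient.out x) (Quotient.out x') h
    rw [← QuotientGroup.out_eq' x, ← QuotientGroup.out_eq' x', QuotientGroup.eq]
    exact Subgroup.mem_subgroupOf.mpr hmem
  have hbij := hψinj.bijective_of_nat_card_le (by
    rw [Nat.card_prod, Nat.card_zmod]; exact hcardQ)
  obtain ⟨x, hx⟩ := hbij.2 ((1 : ZMod 3), (0 : ZMod 3))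
  set a : Z := Quotient.out x with hadef
  have hΦa : Φ a = ((1 : ZMod 3), (0 : ZMod 3)) := hx
  simp only [hΦ, Prod.mk.injEq] at hΦa
  obtain ⟨hΦP, hΦQ⟩ := hΦa
  rw [show (1 : ZMod 3) = ((1 : ℤ) : ZMod 3) by norm_num, ZMod.intCast_eq_intCast_iff_dvd_sub] at hΦP
  rw [show (0 : ZMod 3) = ((0 : ℤ) : ZMod 3) by norm_num, ZMod.intCast_eq_intCast_iff_dvd_sub] at hΦQ
  obtain ⟨c, hc0, i, j, heq, hiP, hjQ⟩ := key (y a) (hy0 a) (hstab a)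
  -- `i ≡ 1`, `j ≡ 0 (mod 3)`
  obtain ⟨i₁, hi₁⟩ : ∃ i₁ : ℤ, i = 1 + 3 * i₁ := by
    obtain ⟨k, hk⟩ : (3 : ℤ) ∣ 1 - i := by
      have h := dvd_add hΦP hiP
      have e : (1 : ℤ) - FractionalIdeal.count N P (FractionalIdeal.spanSingleton (𝓞 N)⁰ (y a)) +
          (FractionalIdeal.count N P (FractionalIdeal.spanSingleton (𝓞 N)⁰ (y a)) - i) = 1 - i := by
        ring
      rw [e] at h
      exact_mod_cast h
    exact ⟨-k, by linarith⟩
  obtain ⟨j₁, hj₁⟩ : ∃ j₁ : ℤ, j = 3 * j₁ := by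
    obtain ⟨k, hk⟩ : (3 : ℤ) ∣ 0 - j := by
      have h := dvd_add hΦQ hjQ
      have e : (0 : ℤ) - FractionalIdeal.count N Q (FractionalIdeal.spanSingleton (𝓞 N)⁰ (y a)) +
          (FractionalIdeal.count N Q (FractionalIdeal.spanSingleton (𝓞 N)⁰ (y a)) - j) = 0 - j := by
        ring
      rw [e] at h
      exact_mod_cast h
    exact ⟨-k, by linarith⟩
  subst hi₁ hj₁
  obtain ⟨hgen, -⟩ := hfixgen c i₁ j₁
  have hP0 : (P.asIdeal : FractionalIdeal (𝓞 N)⁰ N) ≠ 0 :=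
    FractionalIdeal.coeIdeal_ne_zero.mpr P.ne_bot
  set s₀ : N := (c : N) * (p : N) ^ i₁ * (q : N) ^ j₁ with hs₀
  have hs₀0 : s₀ ≠ 0 := by
    have hcN : (c : N) ≠ 0 := by exact_mod_cast hc0
    have hp0 : (p : N) ≠ 0 := by exact_mod_cast hp.ne_zero
    have hq0 : (q : N) ≠ 0 := by exact_mod_cast hq.ne_zero
    exact mul_ne_zero (mul_ne_zero hcN (zpow_ne_zero _ hp0)) (zpow_ne_zero _ hq0)
  have hS0 : FractionalIdeal.spanSingleton (𝓞 N)⁰ s₀ ≠ 0 :=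
    FractionalIdeal.spanSingleton_ne_zero_iff.mpr hs₀0
  -- `(y a) = P · (s₀)`
  have hya : FractionalIdeal.spanSingleton (𝓞 N)⁰ (y a) =
      (P.asIdeal : FractionalIdeal (𝓞 N)⁰ N) * FractionalIdeal.spanSingleton (𝓞 N)⁰ s₀ := by
    rw [heq, ← hgen, zpow_add₀ hP0, zpow_one]
    ring
  refine ⟨y a / s₀, ?_⟩
  rw [div_eq_mul_inv, ← FractionalIdeal.spanSingleton_mul_spanSingleton,
    ← FractionalIdeal.spanSingleton_inv, hya, mul_assoc, mul_inv_cancel₀ hS0, mul_one]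


/-! ### Summary (registered anchor of this helper file) -/

/-- **The totally ramified primes of `N/ℚ(ζ)` are principal**, explicit form (the registered anchor
statement of this helper file). [folklore] -/
theorem genus_isPrincipal_explicit (N : Type) [Field N] [NumberField N] [IsGalois ℚ N]
    (hN : Module.finrank ℚ N = 6) (ζ : N) (hζ : ζ ^ 2 + ζ + 1 = 0) (σ : N ≃ₐ[ℚ] N)
    (hσζ : σ ζ = ζ) (hσ1 : σ ≠ 1) (hnorm : ∀ x : N, x * σ x * σ (σ x) ≠ ζ)
    (p q : ℕ) (hp : p.Prime) (hq : q.Prime) (P Q : HeightOneSpectrum (𝓞 N)) (hPQ : P ≠ Q)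
    (hspanP : Ideal.span {(p : 𝓞 N)} = P.asIdeal ^ 3)
    (hspanQ : Ideal.span {(q : 𝓞 N)} = Q.asIdeal ^ 3)
    (hinvI' : ∀ (I : FractionalIdeal (𝓞 N)⁰ N), I ≠ 0 →
      (∀ g : N ≃ₐ[ℚ] N, g ∈ (ℚ⟮ζ⟯).fixingSubgroup → ∀ x ∈ I, g x ∈ I) →
      ∃ c : ℚ⟮ζ⟯, c ≠ 0 ∧ ∀ w : HeightOneSpectrum (𝓞 N), w ≠ P → w ≠ Q →
        FractionalIdeal.count N w I =
          FractionalIdeal.count N w (FractionalIdeal.spanSingleton (𝓞 N)⁰ ((c : N)))) :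
    ∃ t : N, (P.asIdeal : FractionalIdeal (𝓞 N)⁰ N) = FractionalIdeal.spanSingleton (𝓞 N)⁰ t :=
  genus_isPrincipal hN hζ hσζ hσ1 hnorm hp hq hPQ hspanP hspanQ hinvI'

end Summit.QuantumAdvantage.QuantumAdvantage.Theorems.LinnikCubicClassGroups
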